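import Mathlib
import Summits.MatrixMultiplication.Statement
import Summits.MatrixMultiplication.MatrixMultiplication.Theorems.GraphEquationsCubicRung

/-!
# Graph equations — the base of the finite range of rung 3: `C3₀` and `C3₁` (M37)

Decomp-mm node «GraphEquations» (lens 5 «finite range + asymptotic regime + bridge», g38); attacked
leaf `MultiplicityReduction` (stmt-MatrixMultiplication-27806).  Target of the node, VERBATIM:
`_root_.MatrixMultiplication`.  Route-neutral (`closes` unchanged); imports no `Theses/` file.

`GraphEquationsCubicRung` typed Conjecture C3ₙ = `CubicReduction n` («every correct CUBIC equation
system for `W_n` is generically reduced») and recorded it UNDECIDED for every `n`.  This file PROVES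
the base of its finite range (critic g17 ask (5)):
* `cubicReduction_zero` — C3₀ (the `C`-Jacobian has no columns);
* `cubicReduction_one` — **C3₁**: for `W_1 = {c = ab} ⊂ ℂ³` the ideal is principal, `I(W_1) = (f)`,
  `f = c − ab`; a cubic test is `t = g·f` with `deg g ≤ 1` (`test_eq_mul_fOne`), and
  `∂_c t = g` on `W_1` (`jacobianC_eq_eval_of_mem`); if the system were reduced at NO graph point,
  every `g` would vanish on `W_1`, hence lie in `(f)`, hence be `0` by degree
  (`eq_zero_of_vanishing_of_totalDegree_le_one`) — so every test is `0` and the system accepts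
  `(0, 0, 1) ∉ W_1`, contradicting correctness.  (Remark, not formalised here: the threshold is
  sharp — the single quartic test `f²` is correct and nowhere reduced, the `n = 1` shadow of the
  degree-`4` masked family `GraphEquationsMaskingWitness`; so `C4₁` fails while `C3₁` holds.)
So the finite range of rung 3 now reads: C3₀, C3₁ PROVED; C3₂ INSTRUMENTABLE (kit, unlicensed);
C3ₙ, `n ≥ 3`, IDEA-NEEDED — where the normal form `I(W_n)_{≤3} = ℂ[u,c]_{≤1}·⟨f⟩` of NODE-g38 §2
(`GraphEquationsOneOneSyzygies` is its `(1,1)`-block) replaces «principal ideal» as the rigidity input.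
Why strictly weaker than the summit: statements about cubic polynomial systems in `3n²` variables at
`n ≤ 1`; no cost, no exponent.  No `sorry`.
-/

-- dupNamespace: forced by the nested Summit.MatrixMultiplication.MatrixMultiplication layout (D-0017)
set_option linter.dupNamespace false

noncomputable section

namespace Summit.MatrixMultiplication.MatrixMultiplication.Theorems.GraphEquations

open MvPolynomial

variable {n : ℕ}

/-! ## Rank bookkeeping for the `C`-Jacobian -/

namespace EqSystem

/-- A `C`-Jacobian of rank `0` is the zero matrix. -/
theorem jacobianC_eq_zero_of_rank_eq_zero (E : EqSystem n) (x : GraphVars n → ℂ)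
    (h : (E.jacobianC x).rank = 0) : E.jacobianC x = 0 := by
  classical
  rw [Matrix.rank, Submodule.finrank_eq_zero, LinearMap.range_eq_bot] at h
  ext i j
  have := congr_fun (LinearMap.congr_fun h (Pi.single j 1)) i
  simpa using this

/-- **C3₀**, in fact more: every equation system for `W_0` is generically reduced. -/
theorem genericallyReduced_zero (E : EqSystem 0) : E.GenericallyReduced := by
  refine ⟨0, zero_mem_mmGraph 0, ?_⟩
  have h := Matrix.rank_le_card_width (E.jacobianC 0)
  simp only [Fintype.card_prod, Fintype.card_fin, mul_zero, Nat.le_zero] at h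
  simpa [EqSystem.ReducedAt] using h

end EqSystem

/-- **C3₀.** -/
theorem cubicReduction_zero : CubicReduction 0 := fun E _ _ => E.genericallyReduced_zero

/-! ## `n = 1`: the principal ideal `(f)`, `f = c − ab` -/

/-- `f = c − ab`, the generator of `I(W_1)`. -/
def fOne : MvPolynomial (GraphVars 1) ℂ := generator 1 (0, 0)

/-- `f = c − a·b` explicitly. -/
theorem fOne_eq : fOne = X (Sum.inr (0, 0)) - X (Sum.inl (Sum.inl (0, 0))) * X (Sum.inl (Sum.inr (0, 0))) := by
  simp [fOne, generator]

/-- The generators of `I(W_1)` are just `f`. -/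
theorem range_generator_one : Set.range (generator 1) = {fOne} := by
  ext t
  simp only [Set.mem_range, Set.mem_singleton_iff]
  constructor
  · rintro ⟨q, rfl⟩
    rw [Subsingleton.elim q (0, 0)]; rfl
  · rintro rfl
    exact ⟨(0, 0), rfl⟩

/-- `f` vanishes on `W_1`. -/
theorem eval_fOne_of_mem {x : GraphVars 1 → ℂ} (hx : x ∈ mmGraph 1) : eval x fOne = 0 := by
  have h := hx 0 0
  simp only [Finset.univ_unique, Fin.default_eq_zero, Finset.sum_singleton] at h
  simp [fOne_eq, h]

/-- `∂f/∂c = 1`. -/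
theorem pderiv_c_fOne : pderiv (Sum.inr (0, 0) : GraphVars 1) fOne = 1 := by
  rw [fOne_eq, map_sub, pderiv_mul, pderiv_X_self]
  simp

/-- The monomial `ab` occurs in `f` (with coefficient `−1`), so `2 ≤ deg f`. -/
theorem two_le_totalDegree_fOne : 2 ≤ fOne.totalDegree := by
  classical
  obtain ⟨m, hm⟩ : ∃ m : GraphVars 1 →₀ ℕ, m = Finsupp.single (Sum.inl (Sum.inl (0, 0))) 1 +
      Finsupp.single (Sum.inl (Sum.inr (0, 0))) 1 := ⟨_, rfl⟩
  have hc : Finsupp.single (Sum.inr (0, 0) : GraphVars 1) 1 ≠ m := by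
    intro h
    have := DFunLike.congr_fun h (Sum.inr (0, 0))
    simp [hm] at this
  have hcoeff : coeff m fOne = -1 := by
    rw [fOne_eq, coeff_sub, coeff_X_mul', if_pos (by simp [hm]), X, X, coeff_monomial,
      coeff_monomial, if_neg hc, if_pos (by simp [hm])]
    ring
  have hsupp : m ∈ fOne.support := by simp [mem_support_iff, hcoeff]
  have h := le_totalDegree hsupp
  have hdeg : (m.sum fun _ e => e) = 2 := by
    rw [hm, Finsupp.sum_add_index' (fun _ => rfl) (fun _ _ _ => rfl), Finsupp.sum_single_index rfl,
      Finsupp.sum_single_index rfl]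
  omega

/-- `f ≠ 0`. -/
theorem fOne_ne_zero : fOne ≠ 0 := by
  intro h
  have := two_le_totalDegree_fOne
  rw [h, totalDegree_zero] at this
  omega

/-- A polynomial vanishing on `W_1` is a multiple of `f` (the ideal is principal). -/
theorem exists_eq_mul_fOne_of_vanishing {t : MvPolynomial (GraphVars 1) ℂ}
    (ht : ∀ y ∈ mmGraph 1, eval y t = 0) : ∃ g, t = g * fOne := by
  have h := mem_span_generator_of_vanishing ht
  rw [range_generator_one] at h
  obtain ⟨g, hg⟩ := Ideal.mem_span_singleton'.1 h
  exact ⟨g, hg.symm⟩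

/-- **Degree rigidity at `n = 1`**: a polynomial of total degree `≤ 1` vanishing on `W_1` is `0`. -/
theorem eq_zero_of_vanishing_of_totalDegree_le_one {g : MvPolynomial (GraphVars 1) ℂ}
    (hg : ∀ y ∈ mmGraph 1, eval y g = 0) (hdeg : g.totalDegree ≤ 1) : g = 0 := by
  by_contra hne
  obtain ⟨h, hh⟩ := exists_eq_mul_fOne_of_vanishing hg
  have hh0 : h ≠ 0 := by rintro rfl; exact hne (by simpa using hh)
  have hd := totalDegree_mul_of_isDomain hh0 fOne_ne_zero
  rw [← hh] at hd
  have := two_le_totalDegree_fOne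
  omega

/-- Every test of a correct CUBIC system for `W_1` is `g·f` with `deg g ≤ 1`. -/
theorem test_eq_mul_fOne {E : EqSystem 1} (hE : E.Correct) (h3 : E.IsCubic)
    (o : Fin E.tests.length) :
    ∃ g : MvPolynomial (GraphVars 1) ℂ, g.totalDegree ≤ 1 ∧ E.testPoly (E.tests.get o) = g * fOne := by
  have hvan : ∀ y ∈ mmGraph 1, eval y (E.testPoly (E.tests.get o)) = 0 :=
    fun y hy => hE.eval_testPoly_eq_zero hy (List.get_mem _ _)
  obtain ⟨g, hg⟩ := exists_eq_mul_fOne_of_vanishing hvan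
  refine ⟨g, ?_, hg⟩
  by_cases hg0 : g = 0
  · simp [hg0]
  have hd := totalDegree_mul_of_isDomain hg0 fOne_ne_zero
  rw [← hg] at hd
  have := h3 o
  have := two_le_totalDegree_fOne
  omega

/-- On the graph, the `C`-Jacobian entry of a test `g·f` is `g`: `∂_c(g f)(x) = g(x)` for `x ∈ W_1`. -/
theorem jacobianC_eq_eval_of_mem {E : EqSystem 1} {o : Fin E.tests.length}
    {g : MvPolynomial (GraphVars 1) ℂ} (hg : E.testPoly (E.tests.get o) = g * fOne)
    {x : GraphVars 1 → ℂ} (hx : x ∈ mmGraph 1) : E.jacobianC x o (0, 0) = eval x g := by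
  simp only [EqSystem.jacobianC, Matrix.of_apply, hg, pderiv_mul, pderiv_c_fOne, map_add, map_mul,
    eval_fOne_of_mem hx, mul_zero, zero_add, mul_one]

/-- A correct cubic system for `W_1` is reduced exactly where some cofactor `g_o` does not vanish:
if `g(x) ≠ 0` at a graph point then the system is reduced there. -/
theorem reducedAt_of_eval_ne_zero {E : EqSystem 1} {o : Fin E.tests.length}
    {g : MvPolynomial (GraphVars 1) ℂ} (hg : E.testPoly (E.tests.get o) = g * fOne)
    {x : GraphVars 1 → ℂ} (hx : x ∈ mmGraph 1) (hgx : eval x g ≠ 0) : E.ReducedAt x := by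
  unfold EqSystem.ReducedAt
  have hle := Matrix.rank_le_card_width (E.jacobianC x)
  simp only [Fintype.card_prod, Fintype.card_fin, mul_one] at hle
  rcases Nat.lt_or_ge (E.jacobianC x).rank 1 with hlt | hge
  · exfalso
    have h0 := E.jacobianC_eq_zero_of_rank_eq_zero x (by omega)
    have := congr_fun (congr_fun h0 o) (0, 0)
    rw [jacobianC_eq_eval_of_mem hg hx] at this
    exact hgx (by simpa using this)
  · omega

/-- **C3₁: every correct cubic equation system for `W_1` is generically reduced.** -/
theorem cubicReduction_one : CubicReduction 1 := by
  intro E hE h3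
  by_contra hnot
  -- every cofactor vanishes on the graph, hence is `0`, hence every test is `0`
  have hzero : ∀ o : Fin E.tests.length, E.testPoly (E.tests.get o) = 0 := by
    intro o
    obtain ⟨g, hdeg, hg⟩ := test_eq_mul_fOne hE h3 o
    have hgvan : ∀ y ∈ mmGraph 1, eval y g = 0 := by
      intro y hy
      by_contra hgy
      exact hnot ⟨y, hy, reducedAt_of_eval_ne_zero hg hy hgy⟩
    rw [hg, eq_zero_of_vanishing_of_totalDegree_le_one hgvan hdeg, zero_mul]
  -- so the system accepts `(0, 0, 1) ∉ W_1`
  have hmem : cPoint (fun _ => (1 : ℂ)) ∈ E.zeroSet := by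
    intro j hj
    obtain ⟨o, ho⟩ := List.mem_iff_get.1 hj
    rw [← ho, hzero o, map_zero]
  rw [hE.2, cPoint_mem_mmGraph_iff] at hmem
  exact one_ne_zero (congr_fun hmem (0, 0))

/-- The finite range of rung 3 proved so far: `C3ₙ` for `n ≤ 1`. -/
theorem cubicReduction_of_le_one (hn : n ≤ 1) : CubicReduction n := by
  interval_cases n
  · exact cubicReduction_zero
  · exact cubicReduction_one

end Summit.MatrixMultiplication.MatrixMultiplication.Theorems.GraphEquations

end
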